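import Mathlib
import Summits.ResolutionOfSingularities.ResolutionOfSingularities.Theorems.WildQuotientsWildQuotientResolutionJordanFourThirdTransport
import Summits.ResolutionOfSingularities.ResolutionOfSingularities.Theorems.WildQuotientsWildQuotientResolutionJordanFourConeVertexContraction

/-!
# V4U piece 0, ring brick `H₀` (2/3): the radical identity on the algebra side

(crux stmt-ResolutionOfSingularities-15640 `WildQuotients.WildQuotientResolution`, line `Sketch`,
sector `|G| = p`; programme V4U of `L/w45c/CHAIN.md` v7.5 §4, RULING v7.5 / CORRECTION
2026-08-27T06:30:44Z «H₀ (μ₃ ring brick) = res-type-087»: the radical identity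
`√(ψ⁻¹⟨π^*x_a, π^*x_b, π^*x_c, T_j⟩) = J₀` of lead-1's `H` (p505172), ALGEBRA HALF.
[OURS · L1 W4.5c] — NOT a statement of any manuscript; replaces the role of no printed item.
Prover res-type-087.)

With `U = k[x]` (root chart, slots `ρ = X a`, `β = X b`, `γ = X c`), `S₀ = k[ψ₀(x), q] ⊆ U` the chart-`0`
subring (p490009) and `𝔪 = (X a, X b, X c) ⊆ U`:

* `JordanFour.isIntegral_adjoin_chart0` — `U` is integral over `S₀` (`ρ³, β³, γ³ ∈ S₀`, the other
  variables lie in `S₀`).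
* `JordanFour.radical_span_eq_comap_of_isIntegral` — GENERIC: for an integral extension `S₀ ⊆ U`
  of commutative rings, a prime `M ⊆ U` and `𝔟 ⊆ S₀` with `𝔟 ⊆ M` and `M ⊆ √(𝔟U)`:
  `√(𝔟 S₀) = M ∩ S₀` (lying over).
* `JordanFour.comap_subst0_span_X` — the slot substitution `θ₀` of record (`subst0`, stub-1's
  …ThirdTransport) satisfies `θ₀⁻¹ 𝔪 = 𝔪`: `θ₀ ≡ id` modulo `𝔪` (`N, c′ ∈ 𝔪`, `d′ ≡ X d`).
* `JordanFour.comap_subst0_lift_span_X_eq` / `…_eq'` — composed with stub-4's (γ)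
  `Third112.comap_lift_span_X` (p504476): the contraction of `𝔪` along
  `θ₀ ∘ lift : k[Y] ⧸ ker (Third112.presentation k n a b c) → U` (resp. `… k n b c a`, the
  `p ≡ 2 (mod 3)` slot order) is EXACTLY the vertex ideal `(generator classes)`.
-/

-- single-problem summit: the doubled namespace component `ResolutionOfSingularities` is forced
set_option linter.dupNamespace false

noncomputable section

open MvPolynomial

namespace Summit.ResolutionOfSingularities.ResolutionOfSingularities.Theorems.WildQuotientResolution.JordanFour

/-! ## Generic: radicals of extended-contracted ideals along an integral extension -/

/-- **`√(𝔟 S₀) = M ∩ S₀`** for an injective integral extension `S₀ → U`, a prime `M ⊆ U` and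
`𝔟 ⊆ S₀` with
`𝔟 ⊆ M ⊆ √(𝔟 U)`: every prime `P ⊇ 𝔟` of `S₀` lies under a prime `Q` of `U`, which contains `𝔟 U`,
hence `M` (lying over, `Ideal.exists_ideal_over_prime_of_isIntegral`). [folklore] -/
theorem radical_span_eq_comap_of_isIntegral {S₀ U : Type*} [CommRing S₀] [CommRing U]
    [Algebra S₀ U] [Algebra.IsIntegral S₀ U] (hinj : Function.Injective (algebraMap S₀ U))
    (M : Ideal U) [M.IsPrime] (𝔟 : Set S₀)
    (h𝔟 : ∀ z ∈ 𝔟, algebraMap S₀ U z ∈ M)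
    (hM : M ≤ ((Ideal.span 𝔟).map (algebraMap S₀ U)).radical) :
    (Ideal.span 𝔟).radical = M.comap (algebraMap S₀ U) := by
  apply le_antisymm
  · have h1 : Ideal.span 𝔟 ≤ M.comap (algebraMap S₀ U) := by
      rw [Ideal.span_le]
      intro z hz
      exact h𝔟 z hz
    exact ((Ideal.comap_isPrime (algebraMap S₀ U) M).isRadical).radical_le_iff.mpr h1
  · intro f hf
    rw [Ideal.radical_eq_sInf, Ideal.mem_sInf]
    rintro P ⟨hP𝔟, hP⟩
    obtain ⟨Q, -, hQ, hQP⟩ :=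
      Ideal.exists_ideal_over_prime_of_isIntegral P (⊥ : Ideal U)
        (Ideal.comap_bot_le_of_injective _ hinj)
    have h𝔟Q : (Ideal.span 𝔟).map (algebraMap S₀ U) ≤ Q := by
      rw [Ideal.map_le_iff_le_comap, hQP]
      exact hP𝔟
    have hMQ : M ≤ Q := fun x hx => by
      have hx' := hM hx
      exact (hQ.isRadical.radical_le_iff.mpr h𝔟Q) hx'
    have : f ∈ Q.comap (algebraMap S₀ U) := hMQ hf
    rwa [hQP] at this

/-! ## The chart-`0` subring: integrality of the root chart over it -/

section Chart0

variable (k : Type) [Field k] (n : ℕ) (a b c d : Fin n)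

/-- The chart quotients `q_j` of record (`JordanFour.chart0_ringEquiv_adjoin`). -/
local notation3 "q8" => (![1, X a * X b ^ 2, X b * X c, X c ^ 3, X b ^ 3, X b ^ 2 * X c ^ 2,
  X b * X c ^ 4, X c ^ 6] : Fin 8 → MvPolynomial (Fin n) k)
/-- The root substitution of record `ψ₀`. -/
local notation3 "root0" => (fun s : Fin n => (if s = a then X a ^ 3 else
  X s * X a ^ (if s = b then 2 else if s = c then 1 else 0) : MvPolynomial (Fin n) k))
/-- The chart-`0` subring `S₀ = k[ψ₀(x), q] ⊆ k[x]` of record. -/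
local notation3 "S₀" => Algebra.adjoin k
  (Set.range (fun s : Fin n => MvPolynomial.aeval root0 (X s : MvPolynomial (Fin n) k)) ∪
    Set.range q8)

/-- **`k[x]` is integral over the chart-`0` subring `S₀`**: `ρ³ = ψ₀(x_a)`, `β³ = q₄`, `γ³ = q₃`
lie in `S₀`, and so do the remaining variables `x_i = ψ₀(x_i)`. [OURS · L1 W4.5c] [folklore] -/
theorem isIntegral_adjoin_chart0 (hab : a ≠ b) (hbc : b ≠ c) (hac : a ≠ c) :
    Algebra.IsIntegral (↥S₀) (MvPolynomial (Fin n) k) := by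
  have hmem : ∀ {x : MvPolynomial (Fin n) k}, x ∈ S₀ → IsIntegral (↥S₀) x := fun {x} hx =>
    (isIntegral_algebraMap (R := ↥S₀) (A := MvPolynomial (Fin n) k) (x := ⟨x, hx⟩))
  have hXa : (X a ^ 3 : MvPolynomial (Fin n) k) ∈ S₀ := by
    refine Algebra.subset_adjoin (Set.mem_union_left _ ⟨a, ?_⟩)
    change MvPolynomial.aeval root0 (X a) = X a ^ 3
    rw [aeval_X, if_pos rfl]
  have hXb : (X b ^ 3 : MvPolynomial (Fin n) k) ∈ S₀ :=
    Algebra.subset_adjoin (Set.mem_union_right _ ⟨4, rfl⟩)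
  have hXc : (X c ^ 3 : MvPolynomial (Fin n) k) ∈ S₀ :=
    Algebra.subset_adjoin (Set.mem_union_right _ ⟨3, rfl⟩)
  have hXi : ∀ i, i ≠ a → i ≠ b → i ≠ c → (X i : MvPolynomial (Fin n) k) ∈ S₀ := by
    intro i hia hib hic
    refine Algebra.subset_adjoin (Set.mem_union_left _ ⟨i, ?_⟩)
    change MvPolynomial.aeval root0 (X i) = X i
    rw [aeval_X, if_neg hia, if_neg hib, if_neg hic, pow_zero, mul_one]
  have hX : ∀ i, IsIntegral (↥S₀) (X i : MvPolynomial (Fin n) k) := by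
    intro i
    by_cases hia : i = a
    · subst hia; exact IsIntegral.of_pow three_pos (hmem hXa)
    by_cases hib : i = b
    · subst hib; exact IsIntegral.of_pow three_pos (hmem hXb)
    by_cases hic : i = c
    · subst hic; exact IsIntegral.of_pow three_pos (hmem hXc)
    · exact hmem (hXi i hia hib hic)
  refine ⟨fun x => ?_⟩
  induction x using MvPolynomial.induction_on with
  | C r => exact hmem (Subalgebra.algebraMap_mem _ r)
  | add p q hp hq => exact hp.add hq
  | mul_X p i hp => exact hp.mul (hX i)

/-! ## The slot substitution fixes `𝔪 = (x_a, x_b, x_c)` -/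

/-- **`θ₀⁻¹ (x_a, x_b, x_c) = (x_a, x_b, x_c)`** for the slot substitution `θ₀ = subst0` of record
(`X b ↦ N`, `X c ↦ c′`, `X d ↦ d′`, rest fixed): modulo `𝔪 = (x_a, x_b, x_c)` one has `θ₀ ≡ id`
(`N, c′ ∈ 𝔪`, `d′ ≡ x_d`), so `𝔪 = ker (U → U/𝔪) = ker ((U → U/𝔪) ∘ θ₀) = θ₀⁻¹ 𝔪`.
[OURS · L1 W4.5c] [folklore] -/
theorem comap_subst0_span_X (p : ℕ) (hp : 0 < p) (hbc : b ≠ c) (hbd : b ≠ d) (hcd : c ≠ d) :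
    (Ideal.span ({X a, X b, X c} : Set (MvPolynomial (Fin n) k))).comap
        (subst0 k n a b c d p : MvPolynomial (Fin n) k →+* MvPolynomial (Fin n) k) =
      Ideal.span ({X a, X b, X c} : Set (MvPolynomial (Fin n) k)) := by
  set M : Ideal (MvPolynomial (Fin n) k) := Ideal.span {X a, X b, X c} with hM
  have hXa : (X a : MvPolynomial (Fin n) k) ∈ M := Ideal.subset_span (by simp)
  have hXb : (X b : MvPolynomial (Fin n) k) ∈ M := Ideal.subset_span (by simp)
  have hXc : (X c : MvPolynomial (Fin n) k) ∈ M := Ideal.subset_span (by simp)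
  -- `(U → U/𝔪) ∘ θ₀ = (U → U/𝔪)`
  have key : (Ideal.Quotient.mk M).comp (subst0 k n a b c d p : MvPolynomial (Fin n) k →+*
      MvPolynomial (Fin n) k) = Ideal.Quotient.mk M := by
    refine MvPolynomial.ringHom_ext (fun r => ?_) (fun i => ?_)
    · rw [RingHom.comp_apply, RingHom.coe_coe, MvPolynomial.algHom_C (subst0 k n a b c d p) r]
      rfl
    · rw [RingHom.comp_apply, RingHom.coe_coe, Ideal.Quotient.mk_eq_mk_iff_sub_mem]
      by_cases hib : i = b
      · rw [hib, subst0_X_b]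
        obtain ⟨m, rfl⟩ : ∃ m, p = m + 1 := Nat.exists_eq_succ_of_ne_zero hp.ne'
        have : (X b ^ (m + 1) - X a ^ (m + 1 - 1) * X b - X b : MvPolynomial (Fin n) k) =
            (X b ^ m - X a ^ m - 1) * X b := by
          rw [Nat.add_sub_cancel]; ring
        rw [this]
        exact M.mul_mem_left _ hXb
      by_cases hic : i = c
      · rw [hic, subst0_X_c k n a b c d p hbc]
        have : (C (2⁻¹ : k) * (2 * X c - X b ^ 2 + X a * X b) - X c : MvPolynomial (Fin n) k) =
            (C (2⁻¹ : k) * 2 - 1) * X c + (C (2⁻¹ : k) * (X a - X b)) * X b := by ring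
        rw [this]
        exact M.add_mem (M.mul_mem_left _ hXc) (M.mul_mem_left _ hXb)
      by_cases hid : i = d
      · rw [hid, subst0_X_d k n a b c d p hbd hcd]
        have : (X d - (C (2⁻¹ : k) * (2 * X c - X b ^ 2 + X a * X b)) * X b -
            C (6⁻¹ : k) * (X b ^ 3 - 3 * (X a * X b ^ 2) + 2 * (X a ^ 2 * X b)) - X d :
              MvPolynomial (Fin n) k) =
            (-(C (2⁻¹ : k) * (2 * X c - X b ^ 2 + X a * X b)) -
              C (6⁻¹ : k) * (X b ^ 2 - 3 * (X a * X b) + 2 * X a ^ 2)) * X b := by ring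
        rw [this]
        exact M.mul_mem_left _ hXb
      · rw [subst0_X_of_ne k n a b c d p i hib hic hid, sub_self]
        exact M.zero_mem
  rw [← Ideal.mk_ker (I := M), RingHom.comap_ker, key]

/-! ## With (γ): the contraction of `𝔪` along `θ₀ ∘ lift` is the vertex ideal -/

/-- **`(θ₀ ∘ lift)⁻¹ (x_a, x_b, x_c) = (generator classes)`** for the presented `⅓(1,1,2) × 𝔸` cone
ring `k[Y] ⧸ ker (Third112.presentation k n a b c)` (slot order `(ρ, N, c′)`, `p ≡ 1 (mod 3)`):
`comap_subst0_span_X` + stub-4's (γ) `Third112.comap_lift_span_X`. [OURS · L1 W4.5c]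
[folklore; assembly of landed decls] -/
theorem comap_subst0_lift_span_X_eq (p : ℕ) (hp : 0 < p) (hab : a ≠ b) (hac : a ≠ c)
    (hbc : b ≠ c) (hbd : b ≠ d) (hcd : c ≠ d) :
    (Ideal.span ({X a, X b, X c} : Set (MvPolynomial (Fin n) k))).comap
        ((subst0 k n a b c d p : MvPolynomial (Fin n) k →+* MvPolynomial (Fin n) k).comp
          (Ideal.Quotient.lift (RingHom.ker (Third112.presentation k n a b c).toRingHom)
            (Third112.presentation k n a b c).toRingHom fun _ h => h)) =
      Ideal.span (Set.range (fun l : Fin 7 =>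
        Ideal.Quotient.mk (RingHom.ker (Third112.presentation k n a b c))
          (Third112.gens k n a b c l))) := by
  rw [← Ideal.comap_comap, comap_subst0_span_X k n a b c d p hp hbc hbd hcd]
  exact Third112.comap_lift_span_X k n a b c hab hbc hac

/-- **The same for the permuted slot order `(N, c′, ρ)`** (`p ≡ 2 (mod 3)`: presentation
`Third112.presentation k n b c a`). [OURS · L1 W4.5c] [folklore; assembly of landed decls] -/
theorem comap_subst0_lift_span_X_eq' (p : ℕ) (hp : 0 < p) (hab : a ≠ b) (hac : a ≠ c)
    (hbc : b ≠ c) (hbd : b ≠ d) (hcd : c ≠ d) :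
    (Ideal.span ({X a, X b, X c} : Set (MvPolynomial (Fin n) k))).comap
        ((subst0 k n a b c d p : MvPolynomial (Fin n) k →+* MvPolynomial (Fin n) k).comp
          (Ideal.Quotient.lift (RingHom.ker (Third112.presentation k n b c a).toRingHom)
            (Third112.presentation k n b c a).toRingHom fun _ h => h)) =
      Ideal.span (Set.range (fun l : Fin 7 =>
        Ideal.Quotient.mk (RingHom.ker (Third112.presentation k n b c a))
          (Third112.gens k n b c a l))) := by
  rw [← Ideal.comap_comap, comap_subst0_span_X k n a b c d p hp hbc hbd hcd]
  have hset : ({X a, X b, X c} : Set (MvPolynomial (Fin n) k)) = {X b, X c, X a} := by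
    ext x
    simp only [Set.mem_insert_iff, Set.mem_singleton_iff]
    tauto
  rw [hset]
  exact Third112.comap_lift_span_X k n b c a hbc (Ne.symm hac) (Ne.symm hab)

end Chart0

end Summit.ResolutionOfSingularities.ResolutionOfSingularities.Theorems.WildQuotientResolution.JordanFour

end
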